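import Summits.HodgeConjecture.CorCM.SexticDecicWeilEightfoldParts
import HarnessLib

/-!
# COR-CM — the Hodge conjecture for every product of copies of `E, T, B` — a CM THREEFOLD of `k`-signature `(1,2)` over a SEXTIC CM field
# `K₁ ⊇ k`, a CM FIVEFOLD of `k`-signature `(2,3)` over a DECIC CM field `K₃ ⊇ k`, and the CM curve `E` of `k` — GIVEN ONLY Markman's
# fourfold theorem and hyperbolic-sixfold theorem (frame form; NO Galois hypothesis, no transitivity hypothesis)

Cell `pub-hodgecm2` (COR-CM), seat b30 gen 27 (2026-08-23); count-neutral own lane SEXTIC-DECIC — the ASSEMBLY of the chain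
`Census/SexticDecicWeil{,Defect,Parts,PartsBalanced,Extraction}` + `CorCM/SexticDecicWeil{FrameTransfer,FourfoldParts,SixfoldParts,EightfoldParts}`;
the degree-`(6,10)` twin of gen 26ʼs `CorCM/SexticOcticWeilPowersHodgeOfMarkman.lean`.  Theorems only; no definition, no named fact, no `sorry`.
HONEST FRAMING: a CONDITIONAL result for a NAMED class of CM abelian varieties — `HC_CM` is NOT proved and is not mentioned; the displayed deep
inputs are exactly the two named facts `Markman2025_weilClasses_algebraic_abelianFourfold` (Weil classes of `T × E`) and
`Markman2025_weilClasses_algebraic_hyperbolicSixfold` (Weil classes of `B × E`).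

THE PROOF.  For `X = ⨁_j A(κ j)`, `κ : Fin N → Fin 3`, every rational Hodge class is a sum of weight classes `H(X)_S` over the
`Aut(ℂ)`-balanced weights `S` (Pohlmann, `Pohlmann1968_thm1_cmAlgebra`); a balanced weight is a balanced configuration of the finite model
under the realised pairs of permutations (`modelBalancedSD_of_isGaloisBalancedAlg`, no Galois hypothesis); the realised pairs are stable under a
realised conjugate ROTATION of the five decic pairs (`rot_stable_realisedPairs₅` — Cauchy) and move every sextic pair to `0`
(`exists_mem_realisedPairs₅_apply_eq_zero` — `Aut(ℂ)` transitive on `Hom(K₁, ℂ)`), so the configuration is a disjoint union of parts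
(`modelBalancedSD_induction`): PAIRS (divisor lines), FOUR parts (the Weil class of `T × E`, Markman's fourfold theorem), SIX parts (the Weil
class of `B × E`, Markman's sixfold theorem) and EIGHT parts (`T × B̄`, reached by push–pull through two fresh curves from the four and six
parts); algebraic lines are closed under disjoint union (cup product).

* `hodgeConjectureFor_biproduct_comp_of_frames_of_markman` — MAIN THEOREM (frame form); `…_of_avDominatedBy_…` (everything dominated).
[cite: Markman2025SurveySecant, Thm. 1.2] [cite: Markman2025SecantWeil, Thm 1.5.1] [cite: Pohlmann1968, Thm 1]
[cite: Milne2020HodgeClassesAV, 1.2 (a) and Thm. 1] [cite: Schoen1998HodgeWeilAddendum, §10] [cite: MumfordAV1970, §19]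

## References
* [Markman2025SurveySecant] E. Markman, arXiv:2509.23403, Thm. 1.2.  [Markman2025SecantWeil] E. Markman, arXiv:2502.03415, Thm. 1.5.1.
  [Pohlmann1968] H. Pohlmann, Ann. of Math. 88 (1968), Thm 1.  [Milne2020HodgeClassesAV] J. S. Milne, arXiv:2010.08857, 1.2 (a), Thm. 1.
  [Schoen1998HodgeWeilAddendum] C. Schoen, Compositio Math. 114 (1998), §10.  [MumfordAV1970] D. Mumford, *Abelian Varieties*, §19.
-/

noncomputable section

open CategoryTheory CategoryTheory.Limits NumberField

namespace Summit.HodgeConjecture.CorCM.SexticDecicWeil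

open Literature.AlgebraicGeometry Literature.AlgebraicGeometry.Motives Literature.AlgebraicGeometry.HodgeTheory
open Literature.AlgebraicGeometry.ComplexMultiplication (IsCMTypeRealisation)
open Literature.AlgebraicGeometry.Pohlmann1968
open Literature.AlgebraicTopology.SingularHomology
open Literature.NumberTheory.ComplexMultiplication
open Summit.HodgeConjecture.CorCM.Census.SexticDecicWeil (PtSD ModelBalancedSD IsPairPartSD IsFourPartSD IsSixPartSD IsEightPartSD
  modelBalancedSD_induction)
open Summit.HodgeConjecture.CorCM.SexticOcticWeil (soSlots weilClassesOf_fourfold_le_algebraicClasses_of_frameS_of_markman)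
open Summit.HodgeConjecture.CorCM.DecicWeil23Pair (ext₂)
open Summit.HodgeConjecture.CorCM.PairWeights

open scoped Classical Pointwise

section Assembly

variable {I : Type} {Kf : I → Type} [∀ i, Field (Kf i)] [∀ i, NumberField (Kf i)] [∀ i, IsCMField (Kf i)]
  {i₀ i₁ i₂ : I} {τ : Kf i₀ →+* ℂ}
  {A : Fin 3 → AbelianVariety ℂ} {Φ : ∀ j : Fin 3, CMType (Kf (soSlots i₀ i₁ i₂ j))}
  {ι : ∀ j, 𝓞 (Kf (soSlots i₀ i₁ i₂ j)) →+* End (A j)}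
  {θ : ∀ j, Kf (soSlots i₀ i₁ i₂ j) →+* Module.End ℂ (complexBetti (A j).X 1)}

/-- **MAIN THEOREM (frame form).  The Hodge conjecture for every product of copies `⨁_j A(κ j)` of `E, T, B` — i.e. for `E^a × T^n × B^m`,
all exponents, any order — GIVEN ONLY Markman's fourfold theorem (the Weil classes of `T × E`) and hyperbolic-sixfold theorem (the Weil
classes of `B × E`)**, for `E ⊨ (k; {τ})` (`δ ∈ 𝓞_k`, `δ² = −d`, `τ(δ) = i√d`), `T ⊨ (K₁; Φ 1)` a CM threefold over a SEXTIC CM field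
`K₁ ⊇ i₁(k)` whose type has exactly one member over `τ`, read at position `0` of a frame `e₁` (`hΦ₁`), and `B ⊨ (K₃; Φ 2)` a CM FIVEFOLD over
a DECIC CM field `K₃ ⊇ i₃(k)` whose type has exactly two members over `τ`, read at the positions `0, 1` of a frame `e₃` (`hΦ₃`).  NO Galois
hypothesis and no transitivity hypothesis: the realised rotation of the decic pairs and the transitivity on the sextic pairs are automatic
(`CorCM/SexticDecicWeilFrameTransfer`).  Leaves: the two Markman facts ONLY. [cite: Markman2025SurveySecant, Thm. 1.2]
[cite: Markman2025SecantWeil, Thm 1.5.1] [cite: Pohlmann1968, Thm 1] [cite: Milne2020HodgeClassesAV, 1.2 (a) and Thm. 1]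
[cite: Schoen1998HodgeWeilAddendum, §10] -/
theorem hodgeConjectureFor_biproduct_comp_of_frames_of_markman
    (hW4 : Markman2025_weilClasses_algebraic_abelianFourfold) (hM6 : Markman2025_weilClasses_algebraic_hyperbolicSixfold)
    {N : ℕ} (κ : Fin N → Fin 3) (h6 : Module.finrank ℚ (Kf i₁) = 6) (h10 : Module.finrank ℚ (Kf i₂) = 10)
    (h2 : Module.finrank ℚ (Kf i₀) = 2) (i₁' : Kf i₀ →+* Kf i₁) (i₃' : Kf i₀ →+* Kf i₂)
    {δ : 𝓞 (Kf i₀)} {d : ℕ} (hd : 0 < d) (hδ : ((δ : Kf i₀)) ^ 2 = -(d : Kf i₀)) (hτ : τ (δ : Kf i₀) = Complex.I * (Real.sqrt d : ℂ))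
    (hA : ∀ j, IsCMTypeRealisation (Φ j) (A j) (ι j) (θ j))
    (e₁ : (Kf i₁ →+* ℂ) ≃ Fin 3 × Bool) (e₃ : (Kf i₂ →+* ℂ) ≃ Fin 5 × Bool)
    (he₁_sign : ∀ s : Kf i₁ →+* ℂ, (e₁ s).2 = true ↔ s.comp i₁' = τ)
    (he₃_sign : ∀ t : Kf i₂ →+* ℂ, (e₃ t).2 = true ↔ t.comp i₃' = τ)
    (he₁_conj : ∀ s : Kf i₁ →+* ℂ, e₁ (ComplexEmbedding.conjugate s) = ((e₁ s).1, !(e₁ s).2))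
    (he₃_conj : ∀ t : Kf i₂ →+* ℂ, e₃ (ComplexEmbedding.conjugate t) = ((e₃ t).1, !(e₃ t).2))
    (hΨ : ∀ σ : Kf i₀ →+* ℂ, σ ∈ (Φ 0).1 ↔ σ = τ)
    (hΦ₁ : ∀ s : Kf i₁ →+* ℂ, s ∈ (Φ 1).1 ↔ (e₁ s).2 = decide ((e₁ s).1 = 0))
    (hΦ₃ : ∀ t : Kf i₂ →+* ℂ, t ∈ (Φ 2).1 ↔ (e₃ t).2 = decide ((e₃ t).1 = 0 ∨ (e₃ t).1 = 1)) :
    HodgeConjectureFor (⨁ fun j => A (κ j)).dim (⨁ fun j => A (κ j)).X := by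
  have hττ : ComplexEmbedding.conjugate τ ≠ τ := QuarticCM.conjugate_ne τ
  have hk : ∀ σ : Kf i₀ →+* ℂ, σ = τ ∨ σ = ComplexEmbedding.conjugate τ := fun σ =>
    QuarticCM.eq_or_eq_conjugate_of_quadratic h2 τ σ
  -- the realised pairs: a realised conjugate rotation of the decic pairs; transitive on the sextic pairs (no Galois hypothesis)
  obtain ⟨g, hrot⟩ := rot_stable_realisedPairs₅ (e₁ := e₁) (e₃ := e₃) he₁_sign he₃_sign
  have ht : ∀ x : Fin 3, ∃ π ∈ realisedPairs₅ e₁ e₃, π.1 x = 0 := fun x =>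
    exists_mem_realisedPairs₅_apply_eq_zero he₁_sign he₃_sign x
  -- the Weil planes of `T ⊞ E` and `B × E`, algebraic by Markman's theorems
  have hW₂ := weilClassesOf_fourfold_le_algebraicClasses_of_frameS_of_markman (i₂ := i₂) hW4 h6 h2 i₁' hd hδ hA he₁_sign hΦ₁ hΨ
  have hW₃ := weilClassesOf_sixfold_le_algebraicClasses_of_frameSD_of_markmanSixfold (i₁ := i₁) hM6 h10 h2 i₃' hd hδ hA he₃_sign hΦ₃ hΨ
  -- four and six parts of any product of copies (used on `X` and on `X⁺ = E² ⊞ X`)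
  have hfour : ∀ {N' : ℕ} (κ' : Fin N' → Fin 3) (c : Bool) (G' : Finset ((j : Fin N') × (Kf (soSlots i₀ i₁ i₂ (κ' j)) →+* ℂ))),
      IsFourPartSD (fun x => toPtSD e₁ e₃ τ ((Sigma.map κ' (fun _ => id) :
        ((j : Fin N') × (Kf (soSlots i₀ i₁ i₂ (κ' j)) →+* ℂ)) → ((l : Fin 3) × (Kf (soSlots i₀ i₁ i₂ l) →+* ℂ))) x)) c G' →
      G'.card = 2 * 2 ∧ weightClassesAlg (fun j => A (κ' j)) (fun j => ι (κ' j)) (2 * 2) G' ≤ algebraicClasses (⨁ fun j => A (κ' j)).X 2 :=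
    fun κ' c G' hG' => weightClassesAlg_le_algebraicClasses_of_isFourPartSD κ' hk he₁_sign he₃_sign hA hτ hW₂ hG'
  have hsix : ∀ {N' : ℕ} (κ' : Fin N' → Fin 3) (c : Bool) (G' : Finset ((j : Fin N') × (Kf (soSlots i₀ i₁ i₂ (κ' j)) →+* ℂ))),
      IsSixPartSD (fun x => toPtSD e₁ e₃ τ ((Sigma.map κ' (fun _ => id) :
        ((j : Fin N') × (Kf (soSlots i₀ i₁ i₂ (κ' j)) →+* ℂ)) → ((l : Fin 3) × (Kf (soSlots i₀ i₁ i₂ l) →+* ℂ))) x)) c G' →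
      G'.card = 2 * 3 ∧ weightClassesAlg (fun j => A (κ' j)) (fun j => ι (κ' j)) (2 * 3) G' ≤ algebraicClasses (⨁ fun j => A (κ' j)).X 3 :=
    fun κ' c G' hG' => weightClassesAlg_le_algebraicClasses_of_isSixPartSD κ' hk he₁_sign he₃_sign hA hτ hW₃ hG'
  refine ⟨nonempty_hodgeModel_holds (Motives.AbelianVariety.isSmoothProjective_holds (A := ⨁ fun j => A (κ j))),
    fun p cl hc hH => ?_⟩
  have hAκ : ∀ j, IsCMTypeRealisation (Φ (κ j)) (A (κ j)) (ι (κ j)) (θ (κ j)) := fun j => hA (κ j)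
  -- every balanced configuration has algebraic weight lines: induct over its parts
  have key : ∀ (S : Finset ((j : Fin N) × (Kf (soSlots i₀ i₁ i₂ (κ j)) →+* ℂ))),
      ModelBalancedSD (realisedPairs₅ e₁ e₃) (fun x => toPtSD e₁ e₃ τ ((Sigma.map κ (fun _ => id) :
        ((j : Fin N) × (Kf (soSlots i₀ i₁ i₂ (κ j)) →+* ℂ)) → ((m : Fin 3) × (Kf (soSlots i₀ i₁ i₂ m) →+* ℂ))) x)) S →
      ∀ q, S.card = 2 * q → weightClassesAlg (fun j => A (κ j)) (fun j => ι (κ j)) (2 * q) S ≤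
        algebraicClasses (⨁ fun j => A (κ j)).X q := by
    intro S hS
    refine modelBalancedSD_induction g hrot ht (motive := fun S => ∀ q, S.card = 2 * q →
      weightClassesAlg (fun j => A (κ j)) (fun j => ι (κ j)) (2 * q) S ≤ algebraicClasses (⨁ fun j => A (κ j)).X q)
      (fun q hq => ?_) (fun G S' hGS hG ih q hq => ?_) (fun G S' b hGS hG ih q hq => ?_) (fun G S' b hGS hG ih q hq => ?_)
      (fun G S' b hGS hG ih q hq => ?_) hS
    · obtain rfl : q = 0 := by simpa using hq.symm
      exact fun c' _ => hodgeConjectureFor_codim_zero c'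
    · -- a pair part: a divisor line
      obtain ⟨ha, hGalg⟩ := weightClassesAlg_le_algebraicClasses_of_isPairPartSD κ hττ hk he₁_conj he₃_conj hA hG
      have hRcard : S'.card = 2 * (q - 1) := by
        have h := Finset.card_union_of_disjoint hGS; rw [hq, ha] at h; omega
      have haq : 1 + (q - 1) = q := by
        have h := Finset.card_union_of_disjoint hGS; rw [hq, ha] at h; omega
      rw [← Finset.disjUnion_eq_union G S' hGS]
      exact weightClassesAlg_union_le_algebraicClasses hAκ haq ha hRcard hGS hGalg (ih (q - 1) hRcard)
    · -- a four part: the Weil class of `T × E`, Markman's fourfold theorem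
      obtain ⟨ha, hGalg⟩ := hfour κ b G hG
      have hRcard : S'.card = 2 * (q - 2) := by
        have h := Finset.card_union_of_disjoint hGS; rw [hq, ha] at h; omega
      have haq : 2 + (q - 2) = q := by
        have h := Finset.card_union_of_disjoint hGS; rw [hq, ha] at h; omega
      rw [← Finset.disjUnion_eq_union G S' hGS]
      exact weightClassesAlg_union_le_algebraicClasses hAκ haq ha hRcard hGS hGalg (ih (q - 2) hRcard)
    · -- a six part: the Weil class of `B × E`, Markman's sixfold theorem
      obtain ⟨ha, hGalg⟩ := hsix κ b G hG
      have hRcard : S'.card = 2 * (q - 3) := by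
        have h := Finset.card_union_of_disjoint hGS; rw [hq, ha] at h; omega
      have haq : 3 + (q - 3) = q := by
        have h := Finset.card_union_of_disjoint hGS; rw [hq, ha] at h; omega
      rw [← Finset.disjUnion_eq_union G S' hGS]
      exact weightClassesAlg_union_le_algebraicClasses hAκ haq ha hRcard hGS hGalg (ih (q - 3) hRcard)
    · -- an eight part `T × B̄`: push-pull through `E² ⊞ X`
      obtain ⟨ha, hGalg⟩ := weightClassesAlg_le_algebraicClasses_of_isEightPartSD κ hττ hk he₁_conj he₃_conj hA
        (fun c G' hG' => (hfour (ext₂ κ) c G' hG').2) (fun c G' hG' => (hsix (ext₂ κ) c G' hG').2) hG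
      have hRcard : S'.card = 2 * (q - 4) := by
        have h := Finset.card_union_of_disjoint hGS; rw [hq, ha] at h; omega
      have haq : 4 + (q - 4) = q := by
        have h := Finset.card_union_of_disjoint hGS; rw [hq, ha] at h; omega
      rw [← Finset.disjUnion_eq_union G S' hGS]
      exact weightClassesAlg_union_le_algebraicClasses hAκ haq ha hRcard hGS hGalg (ih (q - 4) hRcard)
  have hmem : cl ∈ ⨆ S ∈ pohlmannSetsAlg (K := fun j => Kf (soSlots i₀ i₁ i₂ (κ j))) (fun j => Φ (κ j)) p,
      weightClassesAlg (fun j => A (κ j)) (fun j => ι (κ j)) (2 * p) S := by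
    rw [← (Pohlmann1968_thm1_cmAlgebra (fun j => Kf (soSlots i₀ i₁ i₂ (κ j))) (fun j => A (κ j))
      (fun j => Φ (κ j)) (fun j => ι (κ j)) (fun j => θ (κ j)) hAκ p).1]
    exact Submodule.subset_span ⟨hc, hH⟩
  have hle : (⨆ S ∈ pohlmannSetsAlg (K := fun j => Kf (soSlots i₀ i₁ i₂ (κ j))) (fun j => Φ (κ j)) p,
      weightClassesAlg (fun j => A (κ j)) (fun j => ι (κ j)) (2 * p) S) ≤
      algebraicClasses (⨁ fun j => A (κ j)).X p := by
    refine iSup₂_le fun S hS => ?_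
    exact key S (modelBalancedSD_of_isGaloisBalancedAlg hττ hk he₁_sign he₁_conj he₃_conj hΨ hΦ₁ hΦ₃ κ hS.2) p hS.1
  exact hle hmem

/-- **The Hodge conjecture for every abelian variety dominated by a product of copies `⨁_j A(κ j)` of `E, T, B`** (frame form, modulo
Markman's two theorems): every abelian variety isogenous to a product of copies of `E, T, B` and their abelian subvarieties and quotients.
[cite: Markman2025SurveySecant, Thm. 1.2] [cite: Markman2025SecantWeil, Thm 1.5.1] [cite: MumfordAV1970, §19] -/
theorem hodgeConjectureFor_of_avDominatedBy_comp_of_frames_of_markman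
    (hW4 : Markman2025_weilClasses_algebraic_abelianFourfold) (hM6 : Markman2025_weilClasses_algebraic_hyperbolicSixfold)
    {N : ℕ} (κ : Fin N → Fin 3) (h6 : Module.finrank ℚ (Kf i₁) = 6) (h10 : Module.finrank ℚ (Kf i₂) = 10)
    (h2 : Module.finrank ℚ (Kf i₀) = 2) (i₁' : Kf i₀ →+* Kf i₁) (i₃' : Kf i₀ →+* Kf i₂)
    {δ : 𝓞 (Kf i₀)} {d : ℕ} (hd : 0 < d) (hδ : ((δ : Kf i₀)) ^ 2 = -(d : Kf i₀)) (hτ : τ (δ : Kf i₀) = Complex.I * (Real.sqrt d : ℂ))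
    (hA : ∀ j, IsCMTypeRealisation (Φ j) (A j) (ι j) (θ j))
    (e₁ : (Kf i₁ →+* ℂ) ≃ Fin 3 × Bool) (e₃ : (Kf i₂ →+* ℂ) ≃ Fin 5 × Bool)
    (he₁_sign : ∀ s : Kf i₁ →+* ℂ, (e₁ s).2 = true ↔ s.comp i₁' = τ)
    (he₃_sign : ∀ t : Kf i₂ →+* ℂ, (e₃ t).2 = true ↔ t.comp i₃' = τ)
    (he₁_conj : ∀ s : Kf i₁ →+* ℂ, e₁ (ComplexEmbedding.conjugate s) = ((e₁ s).1, !(e₁ s).2))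
    (he₃_conj : ∀ t : Kf i₂ →+* ℂ, e₃ (ComplexEmbedding.conjugate t) = ((e₃ t).1, !(e₃ t).2))
    (hΨ : ∀ σ : Kf i₀ →+* ℂ, σ ∈ (Φ 0).1 ↔ σ = τ)
    (hΦ₁ : ∀ s : Kf i₁ →+* ℂ, s ∈ (Φ 1).1 ↔ (e₁ s).2 = decide ((e₁ s).1 = 0))
    (hΦ₃ : ∀ t : Kf i₂ →+* ℂ, t ∈ (Φ 2).1 ↔ (e₃ t).2 = decide ((e₃ t).1 = 0 ∨ (e₃ t).1 = 1))
    {X : AbelianVariety ℂ} (hX : Domination.AVDominatedBy X (⨁ fun j => A (κ j))) :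
    HodgeConjectureFor X.dim X.X :=
  Domination.hodgeConjectureFor_of_avDominatedBy
    (hodgeConjectureFor_biproduct_comp_of_frames_of_markman hW4 hM6 κ h6 h10 h2 i₁' i₃' hd hδ hτ hA e₁ e₃ he₁_sign he₃_sign he₁_conj
      he₃_conj hΨ hΦ₁ hΦ₃) hX

end Assembly

end Summit.HodgeConjecture.CorCM.SexticDecicWeil

end
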